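import Summits.QuantumFields.YangMills.Theorems.UnitScaleTiltHalvingCompetitorMapFibre
import HarnessLib

/-!
# `hP1room` PROGRAMME (LEAD-H «H = hSupUρ3 ⟸ hMember», (K-site) gap (G0)): ★ THE PRE-GAUGE AS AN `SU(2)`-TYPED TORUS GAUGE — J3's units-valued `g` with its
# special-unitary row (✓p645784 `exists_preGauge_chart`, first conjunct) REPACKAGED as the letter `gJ : GaugeTransf P 0 (specialUnitaryGroup (Fin 2) ℂ)` of ✓p647313 ∕ ✓p645686

Route `UnitScaleTilt`, crux K1 child «MinimiserStabilityRegPr» (stmt-QuantumFields-19200), registered stub `stub_halvingStep` (`BirthV10`).  Cell `ym3-torus` (HUMAN RULING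
D-0037: YM₃ on T³ is ladder rung R3 — NOT d = 4, NOT a mass gap, NOT the Clay problem), width seat `ym-ust-20520-w3` gen 6.  `--supports stmt-QuantumFields-19200 --as helper`;
THEOREMS ONLY (0 `def`, 0 `sorry`); count-neutral; nothing here claims `core′`, `hP1room(ρ3)`, `hSupU(ρ3)`, the stub, the crux or the gap.

WHAT.  ★ `exists_suGauge_of_units`: a units-valued torus gauge `g` whose values are special unitary IS `s ↦ toUnits (suIncl (gJ s))` for an `SU(2)`-typed `gJ`; hence
(`unitsField_toUField_gaugeAct`) `(U^{gJ})♯ = (U♯)^g` and `pull (U^{gJ})♯ 0 = pull (U♯)^g 0` — so J3's rows (stated for `g`, ✓p645784) feed the letters `gJ` of ✓p647313,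
✓p645686, ✓p654110, ✓p655738, ✓p657279 and (τ-D) (stated for `U′ := pull (U^{gJ})♯ 0`) by `rw`.  HONEST SCOPE: bookkeeping; no analytic content.

References: T. Bałaban, CMP **98** (1985) 17–51 [Balaban1985Averaging] ((8) p.19, (19) p.21).
-/

set_option autoImplicit false

noncomputable section

namespace Summit.QuantumFields.YangMills.Theorems.HalvingHSiteGaugeSU

open Literature.MathematicalPhysics.QuantumFieldTheory.Balaban1983to89
open B10Eq27TorusAxialLog (pull unitsField toUField suIncl gaugeActT)
open HalvingCompetitorMapFibre (unitsField_toUField_gaugeAct)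

variable {P : Params}

/-- ★ **THE PRE-GAUGE AS AN `SU(2)`-TYPED TORUS GAUGE** — see the module docstring: `g = toUnits ∘ suIncl ∘ gJ` for some `gJ`, with the two readings of the gauged field.
[cite: Balaban1985Averaging, (8) p.19, (19) p.21] -/
theorem exists_suGauge_of_units (g : GaugeTransf P 0 (Matrix (Fin 2) (Fin 2) ℂ)ˣ)
    (hg : ∀ s : Site P 0, ((g s : (Matrix (Fin 2) (Fin 2) ℂ)ˣ) : Matrix (Fin 2) (Fin 2) ℂ) ∈ Matrix.specialUnitaryGroup (Fin 2) ℂ)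
    (U : GaugeField P 0 (Matrix.specialUnitaryGroup (Fin 2) ℂ)) :
    ∃ gJ : GaugeTransf P 0 (Matrix.specialUnitaryGroup (Fin 2) ℂ),
      (fun s => Unitary.toUnits (suIncl (gJ s)) : GaugeTransf P 0 (Matrix (Fin 2) (Fin 2) ℂ)ˣ) = g ∧
      unitsField (toUField (GaugeField.gaugeAct gJ U)) = gaugeActT g (unitsField (toUField U)) ∧
      pull (unitsField (toUField (GaugeField.gaugeAct gJ U))) 0 = pull (gaugeActT g (unitsField (toUField U))) 0 := by
  refine ⟨fun s => ⟨(g s : Matrix (Fin 2) (Fin 2) ℂ), hg s⟩, ?_, ?_, ?_⟩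
  · funext s
    ext
    rfl
  · rw [unitsField_toUField_gaugeAct]
    congr 1
    funext s
    ext
    rfl
  · rw [unitsField_toUField_gaugeAct]
    congr 2
    funext s
    ext
    rfl

end Summit.QuantumFields.YangMills.Theorems.HalvingHSiteGaugeSU

end
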